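import Literature.InformationTheory.QuantumCodes.ToricCodePhenomenologicalProof
import Literature.InformationTheory.QuantumCodes.InhomogeneousDensityBound
import Literature.InformationTheory.QuantumCodes.GraphlikeSyndromes
import HarnessLib

/-!
# The toric code with noisy measurement at DIFFERENT qubit- and measurement-error rates `p ≠ q`:
# `Prob_fail(p, q) → 0` whenever `4ν² ρ(1-ρ) < 1`, `ρ = max(p, q)` — proved

Topic `Literature/InformationTheory/QuantumCodes` (venture QEC, LADDER-QEC rung Q5; qec-type-09 gen 4, item 09.ANISO).
The tree's phenomenological threshold theorems (`ToricCodePhenomenologicalProof.lean`, qec-type-03: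
`phenomFailureProb_le_of_sawCountBound_holds`, `phenomThreshold_of_sawCountBound_holds`, and every Summits tier built
on them) are stated for the ISOTROPIC model `q = p`, although the model itself (`ToricCode.phenomFailureProb L T D p q`,
`phenomenologicalWeight T p q`) carries both of Dennis–Kitaev–Landahl–Preskill's rates ("`p` is the qubit error
probability and `q` is the measurement error probability", §5.1 eq. (HV_prob); "Provided that `p̃ < (4μ₃²)⁻¹`,
`q̃ < (4μ₃²)⁻¹` … the accuracy threshold is surely attained", §5.3 eqs. (threshold_iso), (threshold_iso_num):
"`p, q < .0114`"). This file PROVES the two-rate statement for minimum-weight (hence, by `ToricCodeMatching.lean`, for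
minimum-weight-perfect-matching) space-time decoding:

* **`phenomFailureProb_le_aniso`** — finite size: for `L ≥ 3`, `0 ≤ p, q ≤ ρ ≤ 1/2`, `cₙ(ℤ³) ≤ C νⁿ` and
  `r := 2ν√(ρ(1-ρ)) < 1`, `Prob_fail(p, q) ≤ 2L²(T+1) C r^L / (ν(1-r))` — DKLP eq. (fail_iso) with `p̃, q̃` both
  replaced by the larger `ρ̃ = ρ(1-ρ)`;
* **`phenomThreshold_aniso`** — for every polynomially bounded schedule `T(L)` and every minimum-weight space-time
  decoder family, `Prob_fail(p, q) → 0` whenever `0 ≤ p, q ≤ ρ` and `4ν² ρ(1-ρ) < 1` (so the certified threshold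
  REGION contains the square `max(p, q) < p₀(ν)`; the tiers `ν = 4.778` (kernel), … are Summits corollaries).
Proof = the isotropic proof verbatim (space-time polygon extraction `exists_stPolygon_of_failure`, polygon census
`card_stPolygons_le`, geometric tail) with DKLP's i.i.d. half-density estimate replaced by the inhomogeneous one,
`sum_indepWeight_le_of_cover` (`InhomogeneousDensityBound.lean`: exponential-Markov bound, valid for ANY independent
rates `≤ ρ ≤ 1/2`). The decoder is the UNWEIGHTED minimum-weight decoder (DKLP weight horizontal and vertical links by
`log((1-p)/p)`, `log((1-q)/q)` for `p ≠ q`; that refinement would enlarge the region beyond the square and is not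
attempted here). All PROVED, 0 facts, kernel axioms.

## References
* [DennisEtAl2002] E. Dennis, A. Kitaev, A. Landahl, J. Preskill, *Topological quantum memory*, J. Math. Phys. 43
  (2002) 4452–4505, arXiv:quant-ph/0110143, §5.1 eq. (HV_prob), §5.2 eqs. (saw_prob), (saw_L), §5.3 eqs.
  (threshold_iso), (fail_iso), (threshold_iso_num).
-/

namespace Literature.InformationTheory.QuantumCodes

namespace ToricCode

open Finset Matrix Filter Topology
open Literature.Probability.RandomPlanarGeometry
open Literature.Probability.RandomPlanarGeometry.SAW.Zd

variable {L T : ℕ}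

/-- A history is determined by its support. [cite: DennisEtAl2002, §4.4 (n_E(ℓ) ∈ {0,1})] -/
theorem supp_injective_history [NeZero L] : Function.Injective (supp : History L T → Finset (STLink L T)) :=
  fun x y h => by rw [← indicator_supp x, ← indicator_supp y, h]

/-- The walk-count hypothesis bounds the number of self-avoiding step words of `ℤ³`.
[cite: DennisEtAl2002, §5.3 eqs. (saw_d), (saw_3)] -/
theorem card_sawWords_three_le_of_bound {C ν : ℝ} (h : SAWCountBound3 C ν) (n : ℕ) :
    ((Word.sawWords 3 n).card : ℝ) ≤ C * ν ^ n := by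
  rw [Word.card_sawWords]
  exact h n

/-- The walk-count constant is non-negative (`c₀ = 1 ≤ C`). [cite: DennisEtAl2002, §5.3 eq. (saw_d)] -/
theorem sawCountBound3_nonneg {C ν : ℝ} (h : SAWCountBound3 C ν) : 0 ≤ C := by
  have h0 := h 0
  rw [SAW.Zd.count_zero, pow_zero, mul_one, Nat.cast_one] at h0
  linarith

/-- The phenomenological rates are non-negative when `p, q` are. [cite: DennisEtAl2002, §5.1 eq. (HV_prob)] -/
theorem phenomRate_nonneg {Q C : Type*} {T : ℕ} {p q : ℝ} (hp : 0 ≤ p) (hq : 0 ≤ q)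
    (ℓ : HistoryLoc Q C T) : 0 ≤ phenomRate p q ℓ := by
  cases ℓ <;> simpa [phenomRate]

/-- The phenomenological rates are bounded by `ρ` when `p, q ≤ ρ`. [cite: DennisEtAl2002, §5.1 eq. (HV_prob)] -/
theorem phenomRate_le {Q C : Type*} {T : ℕ} {p q ρ : ℝ} (hp : p ≤ ρ) (hq : q ≤ ρ)
    (ℓ : HistoryLoc Q C T) : phenomRate p q ℓ ≤ ρ := by
  cases ℓ <;> simpa [phenomRate]

/-- **DKLP's finite-size bound for noisy measurement with two rates `p` (qubits) and `q` (measurements),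
proved**: under `cₙ(ℤ³) ≤ C νⁿ`, for `L ≥ 3`, a minimum-weight space-time decoder, `0 ≤ p, q ≤ ρ ≤ 1/2` and
`r := 2ν√(ρ(1-ρ)) < 1`, `Prob_fail(p, q) ≤ 2 L²(T+1) C r^L / (ν (1 - r))`.
[cite: DennisEtAl2002, §5.2–5.3 eqs. (saw_prob), (saw_L), (fail_iso)] -/
theorem phenomFailureProb_le_aniso {C ν : ℝ} (hν : 0 < ν) (hC : SAWCountBound3 C ν) (L T : ℕ) [NeZero L]
    (hL : 3 ≤ L) (D : STDecoder L T) (hD : D.IsMinWeight (stSyn L T) (stCycles L T) hammingNorm)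
    {p q ρ : ℝ} (hp0 : 0 ≤ p) (hq0 : 0 ≤ q) (hpρ : p ≤ ρ) (hqρ : q ≤ ρ) (hρ : ρ ≤ 1 / 2)
    (hr1 : 2 * ν * Real.sqrt (ρ * (1 - ρ)) < 1) :
    phenomFailureProb L T D p q ≤
      2 * (L : ℝ) ^ 2 * ((T : ℝ) + 1) * C * (2 * ν * Real.sqrt (ρ * (1 - ρ))) ^ L /
        (ν * (1 - 2 * ν * Real.sqrt (ρ * (1 - ρ)))) := by
  classical
  set s := Real.sqrt (ρ * (1 - ρ)) with hs
  set r := 2 * ν * s with hr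
  have hs0 : 0 ≤ s := Real.sqrt_nonneg _
  have hr0 : 0 ≤ r := by rw [hr]; positivity
  have h1r : 0 < 1 - r := by linarith
  have hC0 : 0 ≤ C := sawCountBound3_nonneg hC
  -- Step 1: the failing histories, reindexed by their supports; the law is `indepWeight (phenomRate p q)`
  unfold phenomFailureProb
  set F := univ.filter (fun E : History L T => ¬ D.Corrects (stSyn L T) (stTrivial L T) E) with hF
  have hsum : ∑ E ∈ F, phenomenologicalWeight T p q (supp E) =
      ∑ S ∈ F.image supp, indepWeight (phenomRate p q) S := by
    rw [Finset.sum_image fun e₁ _ e₂ _ h => supp_injective_history h]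
    rfl
  rw [hsum]
  -- Step 2: the covering family of long self-avoiding space-time polygons
  set Ps : Finset (Finset (STLink L T)) := univ.filter (fun P =>
    (∃ (x : STASite L) (w : List (Fin 3 × Bool)), IsSTPolygon x w ∧
      ↑(stPolygonEdges x w) ⊆ Set.range (stLinkOf : STLink L T → STALink L) ∧
      stLinks (stPolygonEdges x w) = P) ∧ L ≤ P.card) with hPs
  have hcover : ∀ S ∈ F.image supp, ∃ P ∈ Ps,
      ((fun P : Finset (STLink L T) => P) P).card ≤ 2 * ((fun P : Finset (STLink L T) => P) P ∩ S).card := by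
    intro S hS
    obtain ⟨E, hE, rfl⟩ := Finset.mem_image.1 hS
    have hfail : ¬ D.Corrects (stSyn L T) (stTrivial L T) E := (Finset.mem_filter.1 hE).2
    obtain ⟨x, w, hP, hrange, hLw, hhalf⟩ := exists_stPolygon_of_failure hL hD hfail
    refine ⟨stLinks (stPolygonEdges x w), ?_, ?_⟩
    · rw [hPs, Finset.mem_filter]
      refine ⟨Finset.mem_univ _, ⟨x, w, hP, hrange, rfl⟩, ?_⟩
      rw [card_stLinks hrange, hP.card_stPolygonEdges]
      exact hLw
    · simp only
      rw [card_stLinks hrange, hP.card_stPolygonEdges]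
      exact hhalf
  have h1 := sum_indepWeight_le_of_cover (phenomRate_nonneg hp0 hq0) (phenomRate_le hpρ hqρ) hρ Ps
    (fun P : Finset (STLink L T) => P) (F.image supp) hcover
  -- Step 3: grade the polygons by their number of links `ℓ ∈ [L, #links]`
  set M := Fintype.card (STLink L T) with hM
  have hmaps : ∀ P ∈ Ps, P.card ∈ Finset.Ico L (M + 1) := by
    intro P hP
    rw [hPs, Finset.mem_filter] at hP
    rw [Finset.mem_Ico]
    exact ⟨hP.2.2, Nat.lt_succ_of_le (Finset.card_le_univ P)⟩
  have h2 : ∑ P ∈ Ps, (2 * s) ^ P.card =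
      ∑ H ∈ Finset.Ico L (M + 1), ∑ P ∈ Ps.filter (fun P => P.card = H), (2 * s) ^ P.card :=
    (Finset.sum_fiberwise_of_maps_to hmaps _).symm
  -- Step 4: each fiber has at most `L²(T+1) c_{H-1}(ℤ³) ≤ L²(T+1) C ν^{H-1}` polygons
  have hfiber : ∀ H ∈ Finset.Ico L (M + 1),
      ∑ P ∈ Ps.filter (fun P => P.card = H), (2 * s) ^ P.card ≤
        (L : ℝ) ^ 2 * ((T : ℝ) + 1) * (C * ν ^ (H - 1)) * (2 * s) ^ H := by
    intro H _
    have hcount : ((Ps.filter (fun P => P.card = H)).card : ℝ) ≤ (L : ℝ) ^ 2 * ((T : ℝ) + 1) * (C * ν ^ (H - 1)) := by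
      have hc := card_stPolygons_le hL H (Ps.filter (fun P => P.card = H)) (by
        intro P hP
        rw [Finset.mem_filter, hPs, Finset.mem_filter] at hP
        obtain ⟨⟨-, ⟨x, w, hPw, hrange, rfl⟩, -⟩, hH⟩ := hP
        refine ⟨x, w, hPw, ?_, hrange, rfl⟩
        rw [← hH, card_stLinks hrange, hPw.card_stPolygonEdges])
      calc ((Ps.filter (fun P => P.card = H)).card : ℝ)
          ≤ ((L ^ 2 * (T + 1) * (Word.sawWords 3 (H - 1)).card : ℕ) : ℝ) := by exact_mod_cast hc
        _ = (L : ℝ) ^ 2 * ((T : ℝ) + 1) * ((Word.sawWords 3 (H - 1)).card : ℝ) := by push_cast; ring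
        _ ≤ (L : ℝ) ^ 2 * ((T : ℝ) + 1) * (C * ν ^ (H - 1)) :=
            mul_le_mul_of_nonneg_left (card_sawWords_three_le_of_bound hC (H - 1)) (by positivity)
    calc ∑ P ∈ Ps.filter (fun P => P.card = H), (2 * s) ^ P.card
        = ∑ P ∈ Ps.filter (fun P => P.card = H), (2 * s) ^ H :=
          Finset.sum_congr rfl fun P hP => by rw [(Finset.mem_filter.1 hP).2]
      _ = ((Ps.filter (fun P => P.card = H)).card : ℝ) * (2 * s) ^ H := by
          rw [Finset.sum_const, nsmul_eq_mul]
      _ ≤ (L : ℝ) ^ 2 * ((T : ℝ) + 1) * (C * ν ^ (H - 1)) * (2 * s) ^ H :=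
          mul_le_mul_of_nonneg_right hcount (pow_nonneg (by positivity) _)
  -- Step 5: the geometric tail
  have hterm : ∀ H ∈ Finset.Ico L (M + 1),
      (L : ℝ) ^ 2 * ((T : ℝ) + 1) * (C * ν ^ (H - 1)) * (2 * s) ^ H =
        (L : ℝ) ^ 2 * ((T : ℝ) + 1) * C / ν * r ^ H := by
    intro H hH
    have hH1 : 1 ≤ H := le_trans (by omega : 1 ≤ L) (Finset.mem_Ico.1 hH).1
    obtain ⟨H', rfl⟩ : ∃ H', H = H' + 1 := ⟨H - 1, by omega⟩
    simp only [Nat.add_sub_cancel, hr]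
    field_simp
    ring
  have h3 : ∑ H ∈ Finset.Ico L (M + 1), (L : ℝ) ^ 2 * ((T : ℝ) + 1) * (C * ν ^ (H - 1)) * (2 * s) ^ H =
      (L : ℝ) ^ 2 * ((T : ℝ) + 1) * C / ν * ∑ H ∈ Finset.Ico L (M + 1), r ^ H := by
    rw [Finset.mul_sum]
    exact Finset.sum_congr rfl hterm
  have hgeom := geom_tail_le hr0 hr1 L (M + 1)
  calc ∑ S ∈ F.image supp, indepWeight (phenomRate p q) S
      ≤ ∑ P ∈ Ps, (2 * s) ^ P.card := h1
    _ = ∑ H ∈ Finset.Ico L (M + 1), ∑ P ∈ Ps.filter (fun P => P.card = H), (2 * s) ^ P.card := h2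
    _ ≤ ∑ H ∈ Finset.Ico L (M + 1), (L : ℝ) ^ 2 * ((T : ℝ) + 1) * (C * ν ^ (H - 1)) * (2 * s) ^ H :=
        Finset.sum_le_sum hfiber
    _ = (L : ℝ) ^ 2 * ((T : ℝ) + 1) * C / ν * ∑ H ∈ Finset.Ico L (M + 1), r ^ H := h3
    _ ≤ (L : ℝ) ^ 2 * ((T : ℝ) + 1) * C / ν * (r ^ L / (1 - r)) :=
        mul_le_mul_of_nonneg_left hgeom (by positivity)
    _ ≤ 2 * (L : ℝ) ^ 2 * ((T : ℝ) + 1) * C * r ^ L / (ν * (1 - r)) := by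
        have hX : 0 ≤ (L : ℝ) ^ 2 * ((T : ℝ) + 1) * C / ν * (r ^ L / (1 - r)) := by positivity
        have hν0 : ν ≠ 0 := hν.ne'
        have h1r0 : 1 - r ≠ 0 := h1r.ne'
        have he : 2 * (L : ℝ) ^ 2 * ((T : ℝ) + 1) * C * r ^ L / (ν * (1 - r)) =
            2 * ((L : ℝ) ^ 2 * ((T : ℝ) + 1) * C / ν * (r ^ L / (1 - r))) := by
          field_simp
        rw [he]
        linarith

/-- The failure probability is non-negative for rates in `[0, 1]`. [cite: DennisEtAl2002, §5.2 (Prob_fail)] -/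
theorem phenomFailureProb_nonneg [NeZero L] (D : STDecoder L T) {p q : ℝ} (hp0 : 0 ≤ p) (hq0 : 0 ≤ q)
    (hp1 : p ≤ 1) (hq1 : q ≤ 1) : 0 ≤ phenomFailureProb L T D p q := by
  unfold phenomFailureProb phenomenologicalWeight
  refine Finset.sum_nonneg fun E _ => indepWeight_nonneg (phenomRate_nonneg hp0 hq0) (fun ℓ => ?_) _
  cases ℓ <;> simpa [phenomRate]

/-- **The two-rate (anisotropic) phenomenological threshold, proved.** For `cₙ(ℤ³) ≤ C νⁿ`, every
polynomially bounded schedule `T(L)`, every family of minimum-weight space-time decoders of the `(L+1) × (L+1)`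
toric codes and all rates `0 ≤ p, q ≤ ρ` with `4ν² ρ(1-ρ) < 1` (`ρ ≤ 1/2`): `Prob_fail(p, q) → 0` as `L → ∞`
("Provided that `p̃ < (4μ₃²)⁻¹`, `q̃ < (4μ₃²)⁻¹` … the accuracy threshold is surely attained").
[cite: DennisEtAl2002, §5.3 eqs. (threshold_iso), (fail_iso), (threshold_iso_num)] -/
theorem phenomThreshold_aniso {C ν : ℝ} (hν : 0 < ν) (hC : SAWCountBound3 C ν) {T : ℕ → ℕ}
    (hT : IsPolyBounded T) {D : (L : ℕ) → STDecoder (L + 1) (T L)}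
    (hD : ∀ L, (D L).IsMinWeight (stSyn (L + 1) (T L)) (stCycles (L + 1) (T L)) hammingNorm)
    {p q ρ : ℝ} (hp0 : 0 ≤ p) (hq0 : 0 ≤ q) (hpρ : p ≤ ρ) (hqρ : q ≤ ρ) (hρ : ρ ≤ 1 / 2)
    (h4 : 4 * ν ^ 2 * (ρ * (1 - ρ)) < 1) :
    Tendsto (fun L => phenomFailureProb (L + 1) (T L) (D L) p q) atTop (𝓝 0) := by
  obtain ⟨A, k, hA⟩ := hT
  have hρ0 : 0 ≤ ρ := hp0.trans hpρ
  set s := Real.sqrt (ρ * (1 - ρ)) with hs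
  set r := 2 * ν * s with hr
  have hs0 : 0 ≤ s := Real.sqrt_nonneg _
  have hr0 : 0 ≤ r := by rw [hr]; positivity
  have hρρ : 0 ≤ ρ * (1 - ρ) := mul_nonneg hρ0 (by linarith)
  have hC0 : 0 ≤ C := sawCountBound3_nonneg hC
  have hr1 : r < 1 := by
    have hsq : r ^ 2 = 4 * ν ^ 2 * (ρ * (1 - ρ)) := by
      rw [hr, mul_pow, mul_pow, hs, Real.sq_sqrt hρρ]
      ring
    have h : r ^ 2 < 1 := by rw [hsq]; exact h4
    have := (sq_lt_one_iff_abs_lt_one r).1 h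
    rwa [abs_of_nonneg hr0] at this
  have h1r : 0 < 1 - r := by linarith
  -- `T(L) + 1 ≤ (|A| + 1) (L + 1)^k`
  set B := |A| + 1 with hB
  have hTB : ∀ L : ℕ, ((T L : ℕ) : ℝ) + 1 ≤ B * (((L + 1 : ℕ) : ℝ)) ^ k := by
    intro L
    have h1 : ((T L : ℕ) : ℝ) ≤ A * ((L : ℝ) + 1) ^ k := hA L
    have h2 : A * ((L : ℝ) + 1) ^ k ≤ |A| * ((L : ℝ) + 1) ^ k :=
      mul_le_mul_of_nonneg_right (le_abs_self A) (by positivity)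
    have h3 : (1 : ℝ) ≤ ((L : ℝ) + 1) ^ k := one_le_pow₀ (by linarith [Nat.cast_nonneg (α := ℝ) L])
    push_cast
    rw [hB]
    nlinarith
  have hbound' : ∀ L : ℕ, 2 ≤ L →
      phenomFailureProb (L + 1) (T L) (D L) p q ≤
        2 * B * C / (ν * (1 - r)) * (((L + 1 : ℕ) : ℝ) ^ (k + 2) * r ^ (L + 1)) := by
    intro L hL2
    refine (phenomFailureProb_le_aniso hν hC (L + 1) (T L) (by omega) (D L) (hD L) hp0 hq0 hpρ hqρ hρ hr1).trans ?_
    have hX : 0 ≤ 2 * ((L + 1 : ℕ) : ℝ) ^ 2 * C * r ^ (L + 1) / (ν * (1 - r)) := by positivity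
    calc 2 * ((L + 1 : ℕ) : ℝ) ^ 2 * (((T L : ℕ) : ℝ) + 1) * C * r ^ (L + 1) / (ν * (1 - r))
        = (((T L : ℕ) : ℝ) + 1) * (2 * ((L + 1 : ℕ) : ℝ) ^ 2 * C * r ^ (L + 1) / (ν * (1 - r))) := by
          push_cast; ring
      _ ≤ (B * ((L + 1 : ℕ) : ℝ) ^ k) * (2 * ((L + 1 : ℕ) : ℝ) ^ 2 * C * r ^ (L + 1) / (ν * (1 - r))) :=
          mul_le_mul_of_nonneg_right (hTB L) hX
      _ = 2 * B * C / (ν * (1 - r)) * (((L + 1 : ℕ) : ℝ) ^ (k + 2) * r ^ (L + 1)) := by ring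
  have hnonneg : ∀ L : ℕ, 0 ≤ phenomFailureProb (L + 1) (T L) (D L) p q := fun L =>
    phenomFailureProb_nonneg (D L) hp0 hq0 (hpρ.trans (by linarith)) (hqρ.trans (by linarith))
  have hlim : Tendsto (fun L : ℕ => 2 * B * C / (ν * (1 - r)) * (((L + 1 : ℕ) : ℝ) ^ (k + 2) * r ^ (L + 1)))
      atTop (𝓝 0) := by
    have h0 := tendsto_pow_const_mul_const_pow_of_abs_lt_one (k + 2) (show |r| < 1 by rwa [abs_of_nonneg hr0])
    have h1 : Tendsto (fun L : ℕ => ((L + 1 : ℕ) : ℝ) ^ (k + 2) * r ^ (L + 1)) atTop (𝓝 0) :=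
      (Filter.tendsto_add_atTop_iff_nat 1).2 h0
    have h2 := h1.const_mul (2 * B * C / (ν * (1 - r)))
    rwa [mul_zero] at h2
  refine squeeze_zero' (Filter.Eventually.of_forall hnonneg) ?_ hlim
  rw [Filter.eventually_atTop]
  exact ⟨2, fun L hL => hbound' L hL⟩

/-- **Max form**: `Prob_fail(p, q) → 0` whenever `0 ≤ p, q` and `4ν² ρ(1-ρ) < 1` for `ρ = max(p, q) ≤ 1/2`.
[cite: DennisEtAl2002, §5.3 eqs. (threshold_iso), (threshold_iso_num)] -/
theorem phenomThreshold_aniso_max {C ν : ℝ} (hν : 0 < ν) (hC : SAWCountBound3 C ν) {T : ℕ → ℕ}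
    (hT : IsPolyBounded T) {D : (L : ℕ) → STDecoder (L + 1) (T L)}
    (hD : ∀ L, (D L).IsMinWeight (stSyn (L + 1) (T L)) (stCycles (L + 1) (T L)) hammingNorm)
    {p q : ℝ} (hp0 : 0 ≤ p) (hq0 : 0 ≤ q) (hρ : max p q ≤ 1 / 2)
    (h4 : 4 * ν ^ 2 * (max p q * (1 - max p q)) < 1) :
    Tendsto (fun L => phenomFailureProb (L + 1) (T L) (D L) p q) atTop (𝓝 0) :=
  phenomThreshold_aniso hν hC hT hD hp0 hq0 (le_max_left p q) (le_max_right p q) hρ h4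

end ToricCode

end Literature.InformationTheory.QuantumCodes
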